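import Summits.AtomisticToContinuum.FouriersLaw.Theorems.HiddenChargeMazurNoOddChargeProbes45

/-!
# No odd small-range charges for the pinned anharmonic chain — probes 6 and 7

Support file for item `stmt-AtomisticToContinuum-13514` (`HiddenChargeMazur.NoOddChargeSmallRange`):
every momentum-odd polynomial 3-site density of degree `≤ 4` with a local conservation law of the infinite
pinned anharmonic chain is a coboundary `h ∘ shift − h` (this algebraic half), hence has sub-extensive current
overlap (the analytic half).

Rows extracted from probes 6 and 7 (see `…Probes01` for the scheme).
-/

noncomputable section

open scoped BigOperators
open Literature.MathematicalPhysics.KineticTheory.HeatConduction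

namespace Summit.AtomisticToContinuum.FouriersLaw.Theorems.NoOddCharge

/-! ### Probe 6: real coordinates on `[('q', 0), ('p', 0), ('p', 1), ('q', 2)]`, all other coordinates zero -/

/-- **Rows of site-degree 1 from probe 6.** Expanding the degree-1 graded identity on the probe
configuration and extracting coefficients gives these linear relations among the coefficients. [folklore] -/
theorem probe6_rows1 (c : ℕ → ℝ) (ω₂ : ℝ)
    (h : ∀ σ : ℤ → ℝ × ℝ, (∀ y : ℤ, y < 0 ∨ 4 < y → σ y = 0) →
      lamH ω₂ oddTab1 c (σ) = 0) :
    ∀ ea ∈ ([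
    (![0, 0, 0, 1], -ω₂ * c 0 - ω₂ * c 1 - ω₂ * c 2),
  (![1, 0, 0, 0], -ω₂ * c 0 - ω₂ * c 1 - ω₂ * c 2)] : List ((Fin 4 → ℕ) × ℝ)), ea.2 = 0 := by
  refine rl_extract _ ?_ fun x => Eq.trans ?_ (h (fun y : ℤ =>
    if y = 0 then (x 0, x 1) else if y = 1 then (0, x 2) else if y = 2 then (x 3, 0) else (0, 0)) ?_)
  · simp only [List.map_cons, List.map_nil]
    decide
  · symm
    simp only [lamH, shifts,
      pieceH, Fin.sum_univ_three, Fin.isValue, qslot0, qslot1, qslot2, pslot0,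
      pslot1, pslot2, dT1_0, dT1_1, dT1_2, dT1_3, dT1_4, dT1_5]
    simp only [shiftBy, forceH, Fin.isValue,
      ]
    norm_num
    simp only [Fin.prod_univ_four, Fin.isValue, Matrix.cons_val_zero,
      Matrix.cons_val_one, Matrix.cons_val]
    norm_num
    ring
  · intro y hy
    split_ifs <;> first | rfl | (exfalso; omega)

/-- **Rows of site-degree 2 from probe 6.** Expanding the degree-2 graded identity on the probe
configuration and extracting coefficients gives these linear relations among the coefficients. [folklore] -/
theorem probe6_rows2 (c : ℕ → ℝ) (ω₂ : ℝ)
    (h : ∀ σ : ℤ → ℝ × ℝ, (∀ y : ℤ, y < 0 ∨ 4 < y → σ y = 0) →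
      lamH ω₂ oddTab2 c (σ) = 0) :
    ∀ ea ∈ ([
    (![0, 0, 0, 2], (-ω₂ - 2) * c 3 + c 4 + c 6 + (-ω₂ - 2) * c 7 + c 8 + c 10 + (-ω₂ - 2) * c 11),
  (![0, 0, 2, 0], c 3 + c 7 + c 11),
  (![0, 1, 1, 0], c 4 + c 6 + c 8 + c 10),
  (![0, 2, 0, 0], c 3 + c 7 + c 11),
  (![1, 0, 0, 1], c 4 + (-ω₂ - 2) * c 5 + c 6 + c 8 + (-ω₂ - 2) * c 9 + c 10),
  (![2, 0, 0, 0], (-ω₂ - 2) * c 3 + c 4 + c 6 + (-ω₂ - 2) * c 7 + c 8 + c 10 + (-ω₂ - 2) * c 11)] : List ((Fin 4 → ℕ) × ℝ)), ea.2 = 0 := by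
  refine rl_extract _ ?_ fun x => Eq.trans ?_ (h (fun y : ℤ =>
    if y = 0 then (x 0, x 1) else if y = 1 then (0, x 2) else if y = 2 then (x 3, 0) else (0, 0)) ?_)
  · simp only [List.map_cons, List.map_nil]
    decide
  · symm
    simp only [lamH, shifts,
      pieceH, Fin.sum_univ_three, Fin.isValue, qslot0, qslot1, qslot2, pslot0,
      pslot1, pslot2, dT2_0, dT2_1, dT2_2, dT2_3, dT2_4, dT2_5]
    simp only [shiftBy, win, flat3, forceH, Fin.isValue, Matrix.cons_val_zero, Matrix.cons_val_one,
      Matrix.cons_val]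
    norm_num
    simp only [Fin.prod_univ_four, Fin.isValue, Matrix.cons_val_zero,
      Matrix.cons_val_one, Matrix.cons_val]
    norm_num
    ring
  · intro y hy
    split_ifs <;> first | rfl | (exfalso; omega)

/-- **Rows of site-degree 3 from probe 6.** Expanding the degree-3 graded identity on the probe
configuration and extracting coefficients gives these linear relations among the coefficients. [folklore] -/
theorem probe6_rows3 (c : ℕ → ℝ) (ω₂ lam β : ℝ)
    (h : ∀ σ : ℤ → ℝ × ℝ, (∀ y : ℤ, y < 0 ∨ 4 < y → σ y = 0) →
      lamH ω₂ oddTab3 c (σ) + lamA lam β oddTab1 c (σ) = 0) :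
    ∀ ea ∈ ([
    (![0, 0, 0, 3], -lam * c 0 - lam * c 1 - lam * c 2 + (-ω₂ - 2) * c 22 + c 23 + c 28 +
        (-ω₂ - 2) * c 29 + c 30 + c 38 + (-ω₂ - 2) * c 39),
  (![0, 0, 2, 1], 3 * c 12 + (-ω₂ - 2) * c 14 + 3 * c 15 + c 19 + (-ω₂ - 2) * c 20 + 3 * c 21 +
      c 26 + c 36),
  (![0, 1, 1, 1], 2 * c 13 + (-ω₂ - 2) * c 17 + 2 * c 18 + c 27 + c 32),
  (![0, 2, 0, 1], c 14 + (-ω₂ - 2) * c 19 + c 20 + c 33),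
  (![1, 0, 0, 2], c 23 + (-ω₂ - 2) * c 24 + c 30 + (-ω₂ - 2) * c 31 + c 32),
  (![1, 0, 2, 0], 3 * c 12 + (-ω₂ - 2) * c 13 + 3 * c 15 + c 16 + (-ω₂ - 2) * c 18 + 3 * c 21 +
      c 25 + c 35),
  (![1, 1, 1, 0], 2 * c 13 + (-2 * ω₂ - 4) * c 14 + c 17 + 2 * c 18 + (-2 * ω₂ - 4) * c 20 + c 26 +
      2 * c 28 + c 36 + 2 * c 38),
  (![1, 2, 0, 0], (-3 * ω₂ - 6) * c 12 + c 13 + c 14 + (-3 * ω₂ - 6) * c 15 + c 18 + c 20 +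
      (-3 * ω₂ - 6) * c 21 + 2 * c 22 + 2 * c 29 + 2 * c 39),
  (![2, 0, 0, 1], c 28 + c 32 + (-ω₂ - 2) * c 33 + (-ω₂ - 2) * c 37 + c 38),
  (![3, 0, 0, 0], -lam * c 0 - lam * c 1 - lam * c 2 + (-ω₂ - 2) * c 22 + c 23 + c 28 +
      (-ω₂ - 2) * c 29 + c 30 + c 38 + (-ω₂ - 2) * c 39)] : List ((Fin 4 → ℕ) × ℝ)), ea.2 = 0 := by
  refine rl_extract _ ?_ fun x => Eq.trans ?_ (h (fun y : ℤ =>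
    if y = 0 then (x 0, x 1) else if y = 1 then (0, x 2) else if y = 2 then (x 3, 0) else (0, 0)) ?_)
  · simp only [List.map_cons, List.map_nil]
    decide
  · symm
    simp only [lamH, lamA, shifts,
      pieceH, pieceA, Fin.sum_univ_three, Fin.isValue, qslot0, qslot1, qslot2,
      pslot0, pslot1, pslot2, dT3_0, dT3_1, dT3_2, dT3_3, dT3_4, dT3_5, dT1_3, dT1_4, dT1_5]
    simp only [shiftBy, win, flat3, forceH, forceA, Fin.isValue, Matrix.cons_val_zero,
      Matrix.cons_val_one, Matrix.cons_val]
    norm_num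
    simp only [Fin.prod_univ_four, Fin.isValue, Matrix.cons_val_zero,
      Matrix.cons_val_one, Matrix.cons_val]
    norm_num
    ring
  · intro y hy
    split_ifs <;> first | rfl | (exfalso; omega)

/-- **Rows of site-degree 4 from probe 6.** Expanding the degree-4 graded identity on the probe
configuration and extracting coefficients gives these linear relations among the coefficients. [folklore] -/
theorem probe6_rows4 (c : ℕ → ℝ) (ω₂ lam β : ℝ)
    (h : ∀ σ : ℤ → ℝ × ℝ, (∀ y : ℤ, y < 0 ∨ 4 < y → σ y = 0) →
      lamH ω₂ oddTab4 c (σ) + lamA lam β oddTab2 c (σ) = 0) :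
    ∀ ea ∈ ([
    (![0, 0, 0, 4], (-2 * β - lam) * c 3 + β * c 4 + (-ω₂ - 2) * c 50 + c 51 + β * c 6 +
        (-2 * β - lam) * c 7 + β * c 8 + c 69 + (-ω₂ - 2) * c 70 + c 71 + β * c 10 +
        (-2 * β - lam) * c 11 + c 98 + (-ω₂ - 2) * c 99),
  (![0, 0, 2, 2], (-ω₂ - 2) * c 42 + 3 * c 43 + c 60 + (-ω₂ - 2) * c 61 + 3 * c 62 + c 64 + c 90),
  (![0, 0, 4, 0], c 40 + c 56 + c 81),
  (![0, 1, 1, 2], (-ω₂ - 2) * c 45 + 2 * c 46 + c 65 + c 83),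
  (![0, 1, 3, 0], c 41 + c 53 + c 59 + c 75),
  (![0, 2, 0, 2], (-ω₂ - 2) * c 47 + c 48 + c 84),
  (![0, 2, 2, 0], c 42 + c 54 + c 61 + c 78),
  (![0, 3, 1, 0], c 43 + c 55 + c 62 + c 80),
  (![0, 4, 0, 0], c 40 + c 56 + c 81),
  (![1, 0, 0, 3], c 51 + (-ω₂ - 2) * c 52 + β * c 6 + c 71 + (-2 * β - lam) * c 9 + β * c 10 +
      (-ω₂ - 2) * c 82 + c 83),
  (![1, 0, 2, 1], 3 * c 43 + (-ω₂ - 2) * c 46 + 3 * c 53 + 3 * c 62 + (-ω₂ - 2) * c 74 + 3 * c 75 +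
      c 86),
  (![1, 1, 1, 1], 2 * c 46 + (-2 * ω₂ - 4) * c 48 + 2 * c 54 + (-ω₂ - 2) * c 77 + 2 * c 78 + c 87 +
      2 * c 92),
  (![1, 2, 0, 1], c 48 + (-3 * ω₂ - 6) * c 49 + c 55 + (-ω₂ - 2) * c 79 + c 80 + 2 * c 93),
  (![2, 0, 0, 2], c 83 + (-ω₂ - 2) * c 84 + (-ω₂ - 2) * c 91 + c 92),
  (![2, 0, 2, 0], 3 * c 53 + (-ω₂ - 2) * c 54 + c 57 + c 66 + 3 * c 75 + (-ω₂ - 2) * c 78 + c 95),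
  (![2, 1, 1, 0], 2 * c 54 + (-2 * ω₂ - 4) * c 55 + c 58 + c 67 + 3 * c 69 + 2 * c 78 +
      (-2 * ω₂ - 4) * c 80 + c 96 + 3 * c 98),
  (![2, 2, 0, 0], (-3 * ω₂ - 6) * c 40 + c 41 + 3 * c 50 + c 55 + (-3 * ω₂ - 6) * c 56 + c 59 +
      3 * c 70 + c 80 + (-3 * ω₂ - 6) * c 81 + 3 * c 99),
  (![3, 0, 0, 1], β * c 4 + (-2 * β - lam) * c 5 + β * c 8 + c 69 + c 92 + (-ω₂ - 2) * c 93 +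
      (-ω₂ - 2) * c 97 + c 98),
  (![4, 0, 0, 0], (-2 * β - lam) * c 3 + β * c 4 + (-ω₂ - 2) * c 50 + c 51 + β * c 6 +
      (-2 * β - lam) * c 7 + β * c 8 + c 69 + (-ω₂ - 2) * c 70 + c 71 + β * c 10 +
      (-2 * β - lam) * c 11 + c 98 + (-ω₂ - 2) * c 99)] : List ((Fin 4 → ℕ) × ℝ)), ea.2 = 0 := by
  refine rl_extract _ ?_ fun x => Eq.trans ?_ (h (fun y : ℤ =>
    if y = 0 then (x 0, x 1) else if y = 1 then (0, x 2) else if y = 2 then (x 3, 0) else (0, 0)) ?_)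
  · simp only [List.map_cons, List.map_nil]
    decide
  · symm
    simp only [lamH, lamA, shifts,
      pieceH, pieceA, Fin.sum_univ_three, Fin.isValue, qslot0, qslot1, qslot2,
      pslot0, pslot1, pslot2, dT4_0, dT4_1, dT4_2, dT4_3, dT4_4, dT4_5, dT2_3, dT2_4, dT2_5]
    simp only [shiftBy, win, flat3, forceH, forceA, Fin.isValue, Matrix.cons_val_zero,
      Matrix.cons_val_one, Matrix.cons_val]
    norm_num
    simp only [Fin.prod_univ_four, Fin.isValue, Matrix.cons_val_zero,
      Matrix.cons_val_one, Matrix.cons_val]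
    norm_num
    ring
  · intro y hy
    split_ifs <;> first | rfl | (exfalso; omega)

/-! ### Probe 7: real coordinates on `[('q', 0), ('p', 0), ('q', 3)]`, all other coordinates zero -/

/-- **Rows of site-degree 1 from probe 7.** Expanding the degree-1 graded identity on the probe
configuration and extracting coefficients gives these linear relations among the coefficients. [folklore] -/
theorem probe7_rows1 (c : ℕ → ℝ) (ω₂ : ℝ)
    (h : ∀ σ : ℤ → ℝ × ℝ, (∀ y : ℤ, y < 0 ∨ 4 < y → σ y = 0) →
      lamH ω₂ oddTab1 c (σ) = 0) :
    ∀ ea ∈ ([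
    (![0, 0, 1], -ω₂ * c 0 - ω₂ * c 1 - ω₂ * c 2),
  (![1, 0, 0], -ω₂ * c 0 - ω₂ * c 1 - ω₂ * c 2)] : List ((Fin 3 → ℕ) × ℝ)), ea.2 = 0 := by
  refine rl_extract _ ?_ fun x => Eq.trans ?_ (h (fun y : ℤ =>
    if y = 0 then (x 0, x 1) else if y = 3 then (x 2, 0) else (0, 0)) ?_)
  · simp only [List.map_cons, List.map_nil]
    decide
  · symm
    simp only [lamH, shifts,
      pieceH, Fin.sum_univ_three, Fin.isValue, qslot0, qslot1, qslot2, pslot0,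
      pslot1, pslot2, dT1_0, dT1_1, dT1_2, dT1_3, dT1_4, dT1_5]
    simp only [shiftBy, forceH, Fin.isValue,
      ]
    norm_num
    simp only [Fin.prod_univ_three, Fin.isValue, Matrix.cons_val_zero,
      Matrix.cons_val_one, Matrix.cons_val]
    norm_num
    ring
  · intro y hy
    split_ifs <;> first | rfl | (exfalso; omega)

/-- **Rows of site-degree 2 from probe 7.** Expanding the degree-2 graded identity on the probe
configuration and extracting coefficients gives these linear relations among the coefficients. [folklore] -/
theorem probe7_rows2 (c : ℕ → ℝ) (ω₂ : ℝ)
    (h : ∀ σ : ℤ → ℝ × ℝ, (∀ y : ℤ, y < 0 ∨ 4 < y → σ y = 0) →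
      lamH ω₂ oddTab2 c (σ) = 0) :
    ∀ ea ∈ ([
    (![0, 0, 2], (-ω₂ - 2) * c 3 + c 4 + c 6 + (-ω₂ - 2) * c 7 + c 8 + c 10 + (-ω₂ - 2) * c 11),
  (![0, 2, 0], c 3 + c 7 + c 11),
  (![1, 0, 1], c 5 + c 9),
  (![2, 0, 0], (-ω₂ - 2) * c 3 + c 4 + c 6 + (-ω₂ - 2) * c 7 + c 8 + c 10 + (-ω₂ - 2) * c 11)] : List ((Fin 3 → ℕ) × ℝ)), ea.2 = 0 := by
  refine rl_extract _ ?_ fun x => Eq.trans ?_ (h (fun y : ℤ =>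
    if y = 0 then (x 0, x 1) else if y = 3 then (x 2, 0) else (0, 0)) ?_)
  · simp only [List.map_cons, List.map_nil]
    decide
  · symm
    simp only [lamH, shifts,
      pieceH, Fin.sum_univ_three, Fin.isValue, qslot0, qslot1, qslot2, pslot0,
      pslot1, pslot2, dT2_0, dT2_1, dT2_2, dT2_3, dT2_4, dT2_5]
    simp only [shiftBy, win, flat3, forceH, Fin.isValue, Matrix.cons_val_zero, Matrix.cons_val_one,
      Matrix.cons_val]
    norm_num
    simp only [Fin.prod_univ_three, Fin.isValue, Matrix.cons_val_zero,
      Matrix.cons_val_one, Matrix.cons_val]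
    norm_num
    ring
  · intro y hy
    split_ifs <;> first | rfl | (exfalso; omega)

/-- **Rows of site-degree 3 from probe 7.** Expanding the degree-3 graded identity on the probe
configuration and extracting coefficients gives these linear relations among the coefficients. [folklore] -/
theorem probe7_rows3 (c : ℕ → ℝ) (ω₂ lam β : ℝ)
    (h : ∀ σ : ℤ → ℝ × ℝ, (∀ y : ℤ, y < 0 ∨ 4 < y → σ y = 0) →
      lamH ω₂ oddTab3 c (σ) + lamA lam β oddTab1 c (σ) = 0) :
    ∀ ea ∈ ([
    (![0, 0, 3], -lam * c 0 - lam * c 1 - lam * c 2 + (-ω₂ - 2) * c 22 + c 23 + c 28 +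
        (-ω₂ - 2) * c 29 + c 30 + c 38 + (-ω₂ - 2) * c 39),
  (![0, 2, 1], c 19),
  (![1, 0, 2], c 24),
  (![1, 2, 0], (-3 * ω₂ - 6) * c 12 + c 13 + c 14 + (-3 * ω₂ - 6) * c 15 + c 18 + c 20 +
      (-3 * ω₂ - 6) * c 21 + 2 * c 22 + 2 * c 29 + 2 * c 39),
  (![2, 0, 1], c 37),
  (![3, 0, 0], -lam * c 0 - lam * c 1 - lam * c 2 + (-ω₂ - 2) * c 22 + c 23 + c 28 +
      (-ω₂ - 2) * c 29 + c 30 + c 38 + (-ω₂ - 2) * c 39)] : List ((Fin 3 → ℕ) × ℝ)), ea.2 = 0 := by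
  refine rl_extract _ ?_ fun x => Eq.trans ?_ (h (fun y : ℤ =>
    if y = 0 then (x 0, x 1) else if y = 3 then (x 2, 0) else (0, 0)) ?_)
  · simp only [List.map_cons, List.map_nil]
    decide
  · symm
    simp only [lamH, lamA, shifts,
      pieceH, pieceA, Fin.sum_univ_three, Fin.isValue, qslot0, qslot1, qslot2,
      pslot0, pslot1, pslot2, dT3_0, dT3_1, dT3_2, dT3_3, dT3_4, dT3_5, dT1_3, dT1_4, dT1_5]
    simp only [shiftBy, win, flat3, forceH, forceA, Fin.isValue, Matrix.cons_val_zero,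
      Matrix.cons_val_one, Matrix.cons_val]
    norm_num
    simp only [Fin.prod_univ_three, Fin.isValue, Matrix.cons_val_zero,
      Matrix.cons_val_one, Matrix.cons_val]
    norm_num
    ring
  · intro y hy
    split_ifs <;> first | rfl | (exfalso; omega)

/-- **Rows of site-degree 4 from probe 7.** Expanding the degree-4 graded identity on the probe
configuration and extracting coefficients gives these linear relations among the coefficients. [folklore] -/
theorem probe7_rows4 (c : ℕ → ℝ) (ω₂ lam β : ℝ)
    (h : ∀ σ : ℤ → ℝ × ℝ, (∀ y : ℤ, y < 0 ∨ 4 < y → σ y = 0) →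
      lamH ω₂ oddTab4 c (σ) + lamA lam β oddTab2 c (σ) = 0) :
    ∀ ea ∈ ([
    (![0, 0, 4], (-2 * β - lam) * c 3 + β * c 4 + (-ω₂ - 2) * c 50 + c 51 + β * c 6 +
        (-2 * β - lam) * c 7 + β * c 8 + c 69 + (-ω₂ - 2) * c 70 + c 71 + β * c 10 +
        (-2 * β - lam) * c 11 + c 98 + (-ω₂ - 2) * c 99),
  (![0, 4, 0], c 40 + c 56 + c 81),
  (![1, 0, 3], c 52 + β * c 9),
  (![1, 2, 1], c 79),
  (![2, 2, 0], (-3 * ω₂ - 6) * c 40 + c 41 + 3 * c 50 + c 55 + (-3 * ω₂ - 6) * c 56 + c 59 +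
      3 * c 70 + c 80 + (-3 * ω₂ - 6) * c 81 + 3 * c 99),
  (![3, 0, 1], β * c 5 + c 97),
  (![4, 0, 0], (-2 * β - lam) * c 3 + β * c 4 + (-ω₂ - 2) * c 50 + c 51 + β * c 6 +
      (-2 * β - lam) * c 7 + β * c 8 + c 69 + (-ω₂ - 2) * c 70 + c 71 + β * c 10 +
      (-2 * β - lam) * c 11 + c 98 + (-ω₂ - 2) * c 99)] : List ((Fin 3 → ℕ) × ℝ)), ea.2 = 0 := by
  refine rl_extract _ ?_ fun x => Eq.trans ?_ (h (fun y : ℤ =>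
    if y = 0 then (x 0, x 1) else if y = 3 then (x 2, 0) else (0, 0)) ?_)
  · simp only [List.map_cons, List.map_nil]
    decide
  · symm
    simp only [lamH, lamA, shifts,
      pieceH, pieceA, Fin.sum_univ_three, Fin.isValue, qslot0, qslot1, qslot2,
      pslot0, pslot1, pslot2, dT4_0, dT4_1, dT4_2, dT4_3, dT4_4, dT4_5, dT2_3, dT2_4, dT2_5]
    simp only [shiftBy, win, flat3, forceH, forceA, Fin.isValue, Matrix.cons_val_zero,
      Matrix.cons_val_one, Matrix.cons_val]
    norm_num
    simp only [Fin.prod_univ_three, Fin.isValue, Matrix.cons_val_zero,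
      Matrix.cons_val_one, Matrix.cons_val]
    norm_num
    ring
  · intro y hy
    split_ifs <;> first | rfl | (exfalso; omega)

end Summit.AtomisticToContinuum.FouriersLaw.Theorems.NoOddCharge

end
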